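import Summits.BirchSwinnertonDyer.BirchSwinnertonDyer.Theorems.GenusKolyvaginAtTwoMinimalTwinBSDTwoIdentityDoorSupply
import Summits.BirchSwinnertonDyer.BirchSwinnertonDyer.Theorems.GenusKolyvaginAtTwoMinimalTwinBSDTwoIdentityDoorChebotarevAllImages
import Summits.BirchSwinnertonDyer.BirchSwinnertonDyer.Theorems.GenusKolyvaginAtTwoMinimalTwinBSDTwoEggAllImages
import HarnessLib

/-!
# Route `GenusKolyvaginAtTwo`, crux U₂ `MinimalTwinBSDTwo` (stmt-BirchSwinnertonDyer-22985), LINE 23 «twin_swap»: THE IDENTITY-PRIME DOOR, part 5' —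
# the IDENTITY-DOOR SUPPLY modulo GZK, ALL IMAGES (no `ρ̄₂` hypothesis)

Seat `bsd-line-gk2-p2` g26 (PROVER seat 2/3, cell `bsd-f1-sign2`, LINE 23 holder), `--supports stmt-BirchSwinnertonDyer-22985` (helper; closes nothing).
ONE THEOREM (no definition, no `sorry`); standard axioms; CONDITIONAL only on the print item GZK (`rank_eq_analyticRank_of_analyticRank_le_one`).
**BSD is NOT proved by this file; U₂ is NOT proved; nothing is closed.**

Part 5 (`identityDoorSupplyAtTwo_of_GZK`, file `…IdentityDoorSupply`) VERBATIM with the hypothesis `ρ̄_{W,2}` onto DELETED: on U₂ (`r_an = 1`, hence rank `1`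
by GZK, and `#Sel₂(W) = 2`) the curve has `E(ℚ)[2] = 0` (gk2-p3's `EggAllImages.noRationalTwoTorsion_of_natCard_selmerGroup_eq_two`), so `E[2]` has no non-zero
`Γ_ℚ`-fixed point (gk2's `GenusKolyLowering.forall_geomTorsion_two_eq_zero_of_natCard_torsionBy_eq_one`; `E(ℚ)[2] = 0` read off g23's
`rank_eq_one_and_sha_primary_eq_zero_of_natCard_selmerGroup_eq_two`), which is all the all-images Čebotarev step (part 4d
`exists_identityPrime_pair_not_mem_strictLocalKer_of_noFixed`) needs.  Result: `identityDoorSupplyAtTwo_allImages_of_GZK` — for `W/ℚ` globally minimal,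
non-CM, `r_an = 1`, `#Sel₂(W) = 2`, `Δ_W > 0`, `¬MeetsEgg W`: an identity-door prime Heegner field `K = ℚ(√−ℓ)` (`#W(ℚ_ℓ)[2] = 4`, `Sel₂^{rel ∞}(W)` injective at
`ℓ`, `d_K = −ℓ` odd `≠ −3`, Heegner, `2` split) and a globally minimal model of `W^{(d_K)}`.  With it skeleton v2.1 of LINE 23 has NO declared residual locus:
the identity door covers all of `Δ > 0 ∧ ¬MeetsEgg` (v2.0's OFF‴ = square-`Δ` identity locus included).

References: [MazurRubin2010] Prop. 3.3, Lemma 3.5–3.6; [GrossLMS1991] §1, §9; [SilvermanAEC2009] VIII.8 Cor. 8.3, X.4.2.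
-/

set_option linter.dupNamespace false -- tree convention: `Summit.BirchSwinnertonDyer.BirchSwinnertonDyer.Theorems` (summit = sub-problem)
set_option autoImplicit false

noncomputable section

open scoped Classical

namespace Summit.BirchSwinnertonDyer.BirchSwinnertonDyer.Theorems.GenusExact.TwinSwap.IdentityDoor

open Polynomial WeierstrassCurve NumberField IsDedekindDomain Field
open Literature.NumberTheory.GaloisRepresentations Literature.NumberTheory.EllipticCurves
open Literature.NumberTheory.EllipticCurves.Rank1Residual
open Summit.BirchSwinnertonDyer.BirchSwinnertonDyer.Theorems.KolyvaginEigenTwo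
open Summit.BirchSwinnertonDyer.BirchSwinnertonDyer.Theorems.GenusKolySign
open Summit.BirchSwinnertonDyer.Rank1Residual.F1Sign2 (MeetsEgg NoRationalTwoTorsion ShaTwoTrivial selmerGroupRelaxedAtInfinityAtTwo)
open Summit.BirchSwinnertonDyer.BirchSwinnertonDyer.Theorems.GenusKolyTwin (exists_heegnerField_of_prime prime_discr_facts natCard_twoTorsion_padic_eq
  isRoot_twoTorsionPolynomial_map_zmod_iff)
open Summit.BirchSwinnertonDyer.BirchSwinnertonDyer.Theorems.GenusExact.TwinSwap.Egg (shaTwoTrivial_of_natCard_selmerGroup_eq_two)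

/-! ## §4' The identity-door supply of LINE 23 v2.1 (all images), from GZK -/

/-- **THE IDENTITY-DOOR SUPPLY IS A THEOREM modulo GZK — ALL IMAGES.**  For `W/ℚ` globally minimal, non-CM, `r_an(W) = 1`, `#Sel₂(W) = 2`, `Δ_W > 0`,
`W(ℚ) ⊂ W⁰(ℝ)` (`¬ MeetsEgg`) — NO hypothesis on the image of `ρ̄_{W,2}` —: there are an imaginary quadratic `K = ℚ(√−ℓ)` (`ℓ` prime, `d_K = −ℓ` odd `≠ −3`,
Heegner for `N_W`, `2` split) such that **`ℓ` is an IDENTITY prime (`#W(ℚ_ℓ)[2] = 4`) and no non-zero class of `Sel₂^{rel ∞}(W)` lies in `strictLocalKer_ℓ`**,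
and a globally minimal model of `W^{(d_K)}`.  Proof: GZK gives rank `1`; with `#Sel₂ = 2` this forces `E(ℚ)[2] = 0`, so `E[2]` has no non-zero `Γ_ℚ`-fixed
point; `Sel₂^{rel ∞}(W) = {0, x, y, x + y}` (gk2-p5); the all-images Čebotarev step (part 4d) gives `ℓ ≡ 7 (8)`, `ℓ ≡ −1 (mod p ∣ N_W)`, a Frobenius fixing
`E[2]`, `x, y, x + y ∉ strictLocalKer_ℓ`; prime Heegner field (gk2-p5); global minimal model (Silverman VIII.8).  CONDITIONAL on `hGZK` only; proves nothing
about BSD; closes nothing. [cite: MazurRubin2010, Prop. 3.3, Lemma 3.5–3.6] [cite: GrossLMS1991, §1 (p. 235)] [cite: SilvermanAEC2009, VIII.8 Cor. 8.3, X.4.2] -/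
theorem identityDoorSupplyAtTwo_allImages_of_GZK (hGZK : rank_eq_analyticRank_of_analyticRank_le_one) :
    ∀ (W : WeierstrassCurve ℚ) [W.IsElliptic] [W.IsGloballyMinimal] [NeZero (W.conductorNorm ℤ)],
      ¬ W.HasCM → W.analyticRank = 1 → Nat.card (W.selmerGroup 2) = 2 → 0 < W.Δ → ¬ MeetsEgg W →
      ∃ (K : Type) (_ : Field K) (_ : NumberField K) (ℓ : ℕ) (_ : Fact ℓ.Prime),
        IsImaginaryQuadratic K ∧ NumberField.discr K = -(ℓ : ℤ) ∧
        Nat.card {Q : (W.baseChange ℚ_[ℓ]).toAffine.Point // 2 • Q = 0} = 4 ∧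
        (∀ c ∈ selmerGroupRelaxedAtInfinityAtTwo W, c ∈ MazurRubin2010.strictLocalKer W ℚ_[ℓ] 2 → c = 0) ∧
        Odd (NumberField.discr K) ∧ NumberField.discr K ≠ -3 ∧ SatisfiesHeegnerHypothesis (W.conductorNorm ℤ) K ∧
        ((Ideal.span {(2 : ℤ)}).primesOver (𝓞 K)).ncard = 2 ∧
        ∃ (Wd : WeierstrassCurve ℚ) (_ : Wd.IsElliptic) (_ : Wd.IsGloballyMinimal),
          ∃ C : VariableChange ℚ, C • W.quadraticTwist (NumberField.discr K : ℚ) = Wd := by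
  intro W _ _ _ _hcm hr hSel hΔ hegg
  haveI : Fact (Nat.Prime 2) := ⟨Nat.prime_two⟩
  -- rank one (GZK), the ∞-relaxed Selmer group has order four
  have hrk : W.mordellWeilRank = 1 := by rw [(hGZK W (le_of_eq hr)).1, hr]
  have hT : NoRationalTwoTorsion W := EggAllImages.noRationalTwoTorsion_of_natCard_selmerGroup_eq_two W hSel (le_of_eq hrk.symm)
  -- `E(ℚ)[2] = 0`: no non-zero `Γ_ℚ`-fixed point in `E[2]` (image `S₃` or `C₃`)
  have hnt : ∀ P : geomTorsion W (2 : ℤ), (∀ σ : absoluteGaloisGroup ℚ, σ • P = P) → P = 0 := by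
    obtain ⟨-, hT2, -⟩ := rank_eq_one_and_sha_primary_eq_zero_of_natCard_selmerGroup_eq_two W hSel (le_of_eq hrk.symm)
    refine GenusKolyLowering.forall_geomTorsion_two_eq_zero_of_natCard_torsionBy_eq_one W ?_
    rw [Nat.card_eq_one_iff_exists]
    refine ⟨⟨0, AddSubgroup.zero_mem _⟩, fun P ↦ Subtype.ext (hT2 P.1 ?_)⟩
    have h := congrArg Subtype.val (AddSubgroup.torsionBy.nsmul P)
    simp only [AddSubgroupClass.coe_nsmul, ZeroMemClass.coe_zero] at h
    convert h
  have hSha : ShaTwoTrivial W := shaTwoTrivial_of_natCard_selmerGroup_eq_two W hSel (le_of_eq hrk.symm)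
  have hR4 : Nat.card (selmerGroupRelaxedAtInfinityAtTwo W) = 4 :=
    GenusKolyArch.natCard_selmerGroupRelaxedAtInfinityAtTwo_eq_four_of_not_meetsEgg W hΔ hT hrk hSha hegg
  set R := selmerGroupRelaxedAtInfinityAtTwo W with hRdef
  haveI : Finite R := Nat.finite_of_card_ne_zero (by rw [hR4]; norm_num)
  -- two independent classes `x, y ∈ R`
  obtain ⟨x, hxR, hx0⟩ : ∃ x ∈ R, x ≠ 0 := by
    by_contra h
    push Not at h
    have : Nat.card R = 1 := by
      rw [Nat.card_eq_one_iff_exists]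
      refine ⟨⟨0, R.zero_mem⟩, fun z ↦ Subtype.ext (h z.1 z.2)⟩
    rw [hR4] at this; omega
  obtain ⟨y, hyR, hy0, hyx⟩ : ∃ y ∈ R, y ≠ 0 ∧ y ≠ x := by
    by_contra h
    push Not at h
    haveI : Fintype R := Fintype.ofFinite R
    have hsub : (Finset.univ : Finset R) ⊆ {⟨0, R.zero_mem⟩, ⟨x, hxR⟩} := by
      intro z _
      simp only [Finset.mem_insert, Finset.mem_singleton]
      by_cases hz : z.1 = 0
      · exact Or.inl (Subtype.ext hz)
      · exact Or.inr (Subtype.ext (h z.1 z.2 hz))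
    have hle := Finset.card_le_card hsub
    rw [Finset.card_univ, Fintype.card_eq_nat_card, hR4] at hle
    have : ({⟨0, R.zero_mem⟩, ⟨x, hxR⟩} : Finset R).card ≤ 2 := Finset.card_le_two
    omega
  -- `2`-torsion in `H¹(ℚ, E[2])`
  have hE2 : ∀ P : geomTorsion W ((2 : ℕ) : ℤ), 2 • P = 0 := fun P ↦ AddSubgroup.torsionBy.nsmul P
  have h2H : ∀ g : W.galH1Torsion ((2 : ℕ) : ℤ), g + g = 0 := fun g ↦ by
    rw [← two_nsmul]
    exact galoisCohomology.nsmul_eq_zero_of_forall (W.torsionGaloisModule ((2 : ℕ) : ℤ)) hE2 g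
  -- Čebotarev: an identity twisting prime for the pair `(x, y)`
  have hN : W.conductorNorm ℤ ≠ 0 := (W.conductorNorm_pos_holds).ne'
  obtain ⟨ℓ, hℓF, -, hℓ2N, hℓ8, hℓp, hfrob, hxL, hyL, hxyL⟩ :=
    exists_identityPrime_pair_not_mem_strictLocalKer_of_noFixed W hnt hΔ (x := x) (y := y) hx0 hy0 (Ne.symm hyx) hN 0
  have hℓ : ℓ.Prime := hℓF.out
  have hℓ2 : ℓ ≠ 2 := fun h ↦ hℓ2N (by rw [h]; exact dvd_mul_right 2 _)
  have hℓN : ¬ ℓ ∣ W.conductorNorm ℤ := fun h ↦ hℓ2N (h.mul_left 2)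
  have hℓp' : ∀ p : ℕ, p.Prime → p ∣ W.conductorNorm ℤ → p ≠ 2 → (ℓ : ZMod p) = -1 := by
    intro p _ hp _
    have h : ((ℓ + 1 : ℕ) : ZMod p) = 0 := (ZMod.natCast_eq_zero_iff _ _).mpr (hℓp p hp)
    rw [Nat.cast_add, Nat.cast_one] at h
    exact eq_neg_of_add_eq_zero_left h
  -- the prime Heegner field and a globally minimal model of the twist
  obtain ⟨-, -, K, _, _, hK, hd, hodd, hd3, hH, h2K, -, -⟩ := exists_heegnerField_of_prime W hℓ hℓ8 hℓp'
  have hd0 : ((NumberField.discr K : ℤ) : ℚ) ≠ 0 := by exact_mod_cast NumberField.discr_ne_zero K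
  haveI := W.isElliptic_quadraticTwist hd0
  obtain ⟨C, hC⟩ := hasGlobalMinimalModel_rat_holds (W.quadraticTwist ((NumberField.discr K : ℤ) : ℚ))
  haveI := hC
  -- the identity count and the injectivity on `R`
  have hid : Nat.card {Q : (W.baseChange ℚ_[ℓ]).toAffine.Point // 2 • Q = 0} = 4 :=
    natCard_twoTorsion_padic_eq_four_of_frob_fix W hℓ2 hℓN
      (by obtain ⟨v, 𝔓, F, hv, h𝔓, hF, hfix⟩ := hfrob; exact ⟨v, 𝔓, F, hv, h𝔓, hF, hfix⟩)
  have hinj : ∀ c ∈ R, c ∈ MazurRubin2010.strictLocalKer W ℚ_[ℓ] 2 → c = 0 :=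
    eq_zero_of_mem_of_card_eq_four R (MazurRubin2010.strictLocalKer W ℚ_[ℓ] 2) hR4 h2H hxR hyR hx0 hy0 (Ne.symm hyx) hxL hyL hxyL
  exact ⟨K, inferInstance, inferInstance, ℓ, hℓF, hK, hd, hid, hinj, hodd, hd3, hH, h2K,
    C • W.quadraticTwist ((NumberField.discr K : ℤ) : ℚ), inferInstance, hC, C, rfl⟩

end Summit.BirchSwinnertonDyer.BirchSwinnertonDyer.Theorems.GenusExact.TwinSwap.IdentityDoor

end
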